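import Summits.AtomisticToContinuum.Crystallization.Theorems.ExcessDecayLiouvilleEquationRemainder
import Summits.AtomisticToContinuum.Crystallization.Theorems.ExcessDecayLiouvilleLinearisedEquation
import Summits.AtomisticToContinuum.Crystallization.Theorems.ExcessDecayLiouvilleDifferenceQuotient

/-!
# Route `ExcessDecayLiouville`: the operator row of the cut-off displacement — exact identity (nonlinear half, II)

Harmonic-replacement architecture for item `ExcessDecay` (stmt-AtomisticToContinuum-9334), nonlinear half.
At a matched site `s` of the ball `dist · c ≤ r` (matching `π`, displacement `u = π − id`), for ANY
background field `g` and ANY weight `χ` with `χ s = 1` vanishing at the sites outside the ball, the operator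
row of the cut-off relative displacement `v = χ • (u − g)` is, EXACTLY,

`(L v)(s) = − Σ_{s'} F(e + Dg) − E(s) − Σ_{s'} [R(e, Dg + Dṽ) − R(e, Dg)] + T_χ(s)`

(`e = s − s'`, `ṽ = u − g`, `D` the bond difference, sums over the sites `s' ≠ s` of the ball, `E(s)` the
exterior force, `T_χ(s)` the two cutoff tails).  The first sum is the total pair force at `s` of the ball
displaced by the background alone — for an affine-plus-shift background its infinite-lattice version is
sublattice-constant; the third is the flux of the antisymmetric, Lipschitz-small modified remainder.

* `pairForce_bond_split` : `F(e + (a + d)) = F(e + a) + K(e) d + (R(e, a + d) − R(e, a))`;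
* `sum_pairForce_eq_neg_rest` : force balance at `π s` as `Σ_{s'} F(e + Du) = −E(s)`;
* `opRow_cutoff_identity` : the identity above.

All `[folklore]`; helper lemmas, nothing here closes an item.
-/

noncomputable section

namespace Summit.AtomisticToContinuum.Crystallization.Theorems.ExcessDecayLiouville

open scoped BigOperators Topology InnerProductSpace RealInnerProductSpace Classical
open Literature.MathematicalPhysics.StatisticalMechanics
open Summit.AtomisticToContinuum.Crystallization.Theorems.PhononStabilityNegative

-- Local notation: the force-constant map `K(e)w = h(|e|²)w + 2⟪e,w⟫h′(|e|²)e`.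
local notation3 "𝕂[" e "] " w:max =>
  (-((‖e‖ ^ 2)⁻¹) ^ 7 + ((‖e‖ ^ 2)⁻¹) ^ 4) • w + (2 * ⟪e, w⟫ * (7 * ((‖e‖ ^ 2)⁻¹) ^ 8 - 4 * ((‖e‖ ^ 2)⁻¹) ^ 5)) • e
-- Local notation: the pair force `F(x) = h(|x|²) x`.
local notation3 "𝐅[" x "]" => ((-((‖x‖ ^ 2)⁻¹) ^ 7 + ((‖x‖ ^ 2)⁻¹) ^ 4) • x)
-- Local notation: the remainder `R(e, w) = F(e + w) − F(e) − K(e) w`.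
local notation3 "ℛ[" e ", " w "]" => (𝐅[e + w] - 𝐅[e] - 𝕂[e] w)

section

variable {X : Set (EuclideanSpace ℝ (Fin 3))} {c : EuclideanSpace ℝ (Fin 3)} {r ε : ℝ}
  {t : Fin 2 → EuclideanSpace ℝ (Fin 3)} {A : EuclideanSpace ℝ (Fin 3) →L[ℝ] EuclideanSpace ℝ (Fin 3)}
  {π : EuclideanSpace ℝ (Fin 3) → EuclideanSpace ℝ (Fin 3)}

set_option quotPrecheck false in
-- Local notation: the operator row `(L v)(p)`.
local notation "𝕃" v:max " @ " p:max =>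
  tsum (fun q : Sites₀ t A => (if ((p : Sites₀ t A) : EuclideanSpace ℝ (Fin 3)) ≠ q then
    𝕂[((p : Sites₀ t A) : EuclideanSpace ℝ (Fin 3)) - q] (v ((p : Sites₀ t A) : EuclideanSpace ℝ (Fin 3)) - v q) else 0))

/-! ## Per-bond splitting -/

/-- **Per-bond splitting of the displaced pair force**:
`F(e + (a + d)) = F(e + a) + K(e) d + (R(e, a + d) − R(e, a))`. [folklore] -/
theorem pairForce_bond_split (e a d : EuclideanSpace ℝ (Fin 3)) :
    𝐅[e + (a + d)] = 𝐅[e + a] + 𝕂[e] d + (ℛ[e, a + d] - ℛ[e, a]) := by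
  rw [forceConst_add_right e a d]
  abel

/-! ## Force balance as a finite identity -/

/-- **Force balance at a matched particle**: `Σ_{s' ≠ s in the ball} F((s − s') + (u s − u s')) = −E(s)`,
`E(s)` the force of the exterior particles. [folklore] -/
theorem sum_pairForce_eq_neg_rest (hX : X.Finite)
    (hπ : ∀ s' ∈ Sites₀ t A, dist s' c ≤ r → π s' ∈ X ∧ dist (π s') s' ≤ ε)
    (hinj : ∀ s₁ ∈ Sites₀ t A, ∀ s₂ ∈ Sites₀ t A, dist s₁ c ≤ r → dist s₂ c ≤ r → π s₁ = π s₂ → s₁ = s₂)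
    {s : EuclideanSpace ℝ (Fin 3)} (hs : s ∈ Sites₀ t A) (hsc : dist s c ≤ r)
    (SR : Finset (EuclideanSpace ℝ (Fin 3))) (hSR : ∀ x, x ∈ SR ↔ x ∈ Sites₀ t A ∧ dist x c ≤ r)
    (hEq : HasSum (fun q : {q : EuclideanSpace ℝ (Fin 3) // q ∈ X ∧ q ≠ π s} =>
      (deriv lennardJones (dist (π s) q) / dist (π s) q) • (π s - (q : EuclideanSpace ℝ (Fin 3)))) 0) :
    ∑ s' ∈ SR.erase s, 𝐅[(s - s') + ((π s - s) - (π s' - s'))] =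
      -∑ q ∈ (hX.toFinset.erase (π s)) \ ((SR.erase s).image π),
        (deriv lennardJones (dist (π s) q) / dist (π s) q) • (π s - q) := by
  classical
  have hsub : (SR.erase s).image π ⊆ hX.toFinset.erase (π s) := by
    intro q hq
    rw [Finset.mem_image] at hq
    obtain ⟨s', hs', rfl⟩ := hq
    rw [Finset.mem_erase] at hs' ⊢
    obtain ⟨hne, hs'SR⟩ := hs'
    obtain ⟨hs'S, hs'c⟩ := (hSR s').1 hs'SR
    refine ⟨fun h => hne (hinj s' hs'S s hs hs'c hsc h), ?_⟩
    rw [Set.Finite.mem_toFinset]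
    exact (hπ s' hs'S hs'c).1
  have hinjOn : Set.InjOn π (SR.erase s : Finset (EuclideanSpace ℝ (Fin 3))) := by
    intro s₁ hs₁ s₂ hs₂ h
    have h1 := (hSR s₁).1 (Finset.mem_erase.1 hs₁).2
    have h2 := (hSR s₂).1 (Finset.mem_erase.1 hs₂).2
    exact hinj s₁ h1.1 s₂ h2.1 h1.2 h2.2 h
  have hbal := sum_erase_eq_zero_of_hasSum hX hEq
  have hsplit := Finset.sum_sdiff hsub
    (f := fun q => (deriv lennardJones (dist (π s) q) / dist (π s) q) • (π s - q))
  rw [hbal, Finset.sum_image hinjOn] at hsplit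
  have hterm : ∀ s' ∈ SR.erase s,
      (deriv lennardJones (dist (π s) (π s')) / dist (π s) (π s')) • (π s - π s') =
        𝐅[(s - s') + ((π s - s) - (π s' - s'))] := by
    intro s' hs'
    obtain ⟨hne, hs'SR⟩ := Finset.mem_erase.1 hs'
    obtain ⟨hs'S, hs'c⟩ := (hSR s').1 hs'SR
    have hpp : π s ≠ π s' := fun h => hne (hinj s' hs'S s hs hs'c hsc h.symm)
    have hvec : π s - π s' = (s - s') + ((π s - s) - (π s' - s')) := by abel
    rw [dist_eq_norm, ljForce_eq_smul (sub_ne_zero.2 hpp), hvec]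
  rw [← Finset.sum_congr rfl hterm, eq_neg_iff_add_eq_zero, add_comm]
  exact hsplit

/-! ## The operator row of the cut-off relative displacement -/

/-- **Exact identity for the operator row of `v = χ • (u − g)`** at a matched site `s` with `χ s = 1`,
`χ = 0` at the sites outside the ball (see the module docstring). [folklore] -/
theorem opRow_cutoff_identity (hA : Adm₀ A) (hI : Inner₀ t A) (hX : X.Finite)
    (hπ : ∀ s' ∈ Sites₀ t A, dist s' c ≤ r → π s' ∈ X ∧ dist (π s') s' ≤ ε)
    (hinj : ∀ s₁ ∈ Sites₀ t A, ∀ s₂ ∈ Sites₀ t A, dist s₁ c ≤ r → dist s₂ c ≤ r → π s₁ = π s₂ → s₁ = s₂)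
    {s : EuclideanSpace ℝ (Fin 3)} (hs : s ∈ Sites₀ t A) (hsc : dist s c ≤ r)
    (SR : Finset (EuclideanSpace ℝ (Fin 3))) (hSR : ∀ x, x ∈ SR ↔ x ∈ Sites₀ t A ∧ dist x c ≤ r)
    (hEq : HasSum (fun q : {q : EuclideanSpace ℝ (Fin 3) // q ∈ X ∧ q ≠ π s} =>
      (deriv lennardJones (dist (π s) q) / dist (π s) q) • (π s - (q : EuclideanSpace ℝ (Fin 3)))) 0)
    (g : EuclideanSpace ℝ (Fin 3) → EuclideanSpace ℝ (Fin 3)) (χ : EuclideanSpace ℝ (Fin 3) → ℝ) (hχs : χ s = 1)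
    (hχ0 : ∀ q ∈ Sites₀ t A, q ∉ SR → χ q = 0)
    (hv : (Function.support (fun x => χ x • ((π x - x) - g x))).Finite) :
    𝕃 (fun x => χ x • ((π x - x) - g x)) @ (⟨s, hs⟩ : Sites₀ t A) =
      -(∑ s' ∈ SR.erase s, 𝐅[(s - s') + (g s - g s')]) -
      (∑ q ∈ (hX.toFinset.erase (π s)) \ ((SR.erase s).image π),
        (deriv lennardJones (dist (π s) q) / dist (π s) q) • (π s - q)) -
      (∑ s' ∈ SR.erase s, (ℛ[s - s', (g s - g s') + (((π s - s) - g s) - ((π s' - s') - g s'))] -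
        ℛ[s - s', g s - g s'])) +
      ((∑ s' ∈ SR.erase s, 𝕂[s - s'] ((1 - χ s') • ((π s' - s') - g s'))) +
        ∑' q : ↑((SR.subtype (· ∈ Sites₀ t A) : Set (Sites₀ t A)))ᶜ,
          (if s ≠ (q : EuclideanSpace ℝ (Fin 3)) then 𝕂[s - (q : EuclideanSpace ℝ (Fin 3))] ((π s - s) - g s) else 0)) := by
  classical
  -- abbreviations
  set u : EuclideanSpace ℝ (Fin 3) → EuclideanSpace ℝ (Fin 3) := fun x => π x - x with hu
  set w : EuclideanSpace ℝ (Fin 3) → EuclideanSpace ℝ (Fin 3) := fun x => (π x - x) - g x with hw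
  set v : EuclideanSpace ℝ (Fin 3) → EuclideanSpace ℝ (Fin 3) := fun x => χ x • ((π x - x) - g x) with hvdef
  -- (1) force balance, split per bond
  have hbal := sum_pairForce_eq_neg_rest hX hπ hinj hs hsc SR hSR hEq
  have hbond : ∀ s' ∈ SR.erase s, 𝐅[(s - s') + ((π s - s) - (π s' - s'))] =
      𝐅[(s - s') + (g s - g s')] + 𝕂[s - s'] (w s - w s') +
        (ℛ[s - s', (g s - g s') + (w s - w s')] - ℛ[s - s', g s - g s']) := by
    intro s' _
    have hsplit : (π s - s) - (π s' - s') = (g s - g s') + (w s - w s') := by simp only [hw]; abel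
    rw [hsplit]
    exact pairForce_bond_split _ _ _
  rw [Finset.sum_congr rfl hbond, Finset.sum_add_distrib, Finset.sum_add_distrib] at hbal
  -- hbal : ΣF(e+Dg) + ΣK Dw + ΣR̃ = −Rest
  -- (2) the operator row of v, split over the sites of the ball and the rest
  have hsum := summable_opRow hA hI hv (⟨s, hs⟩ : Sites₀ t A)
  have hsplit := hsum.sum_add_tsum_compl (s := SR.subtype (· ∈ Sites₀ t A))
  rw [← hsplit]
  -- the finite part, as a sum over `SR`, then over `SR.erase s`
  have hmem : ∀ x ∈ SR, x ∈ Sites₀ t A := fun x hx => ((hSR x).1 hx).1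
  have hfin : ∑ q ∈ SR.subtype (· ∈ Sites₀ t A),
      (if s ≠ (q : EuclideanSpace ℝ (Fin 3)) then 𝕂[s - (q : EuclideanSpace ℝ (Fin 3))] (v s - v q) else 0) =
      ∑ x ∈ SR, (if s ≠ x then 𝕂[s - x] (v s - v x) else 0) :=
    Finset.sum_subtype_of_mem (f := fun x => if s ≠ x then 𝕂[s - x] (v s - v x) else 0) hmem
  have hsSR : s ∈ SR := (hSR s).2 ⟨hs, hsc⟩
  have herase : ∑ x ∈ SR, (if s ≠ x then 𝕂[s - x] (v s - v x) else 0) =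
      ∑ x ∈ SR.erase s, 𝕂[s - x] (v s - v x) := by
    rw [← Finset.add_sum_erase SR _ hsSR, if_neg (fun h => h rfl), zero_add]
    refine Finset.sum_congr rfl fun x hx => ?_
    rw [if_pos (Ne.symm (Finset.mem_erase.1 hx).1)]
  -- on the ball: v s − v s' = (w s − w s') + (1 − χ s') • w s'
  have hvs : v s = w s := by simp only [hvdef, hw, hχs, one_smul]
  have hball : ∀ x ∈ SR.erase s, 𝕂[s - x] (v s - v x) = 𝕂[s - x] (w s - w x) + 𝕂[s - x] ((1 - χ x) • w x) := by
    intro x _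
    have : v s - v x = (w s - w x) + (1 - χ x) • w x := by
      rw [hvs]; simp only [hvdef, hw, sub_smul, one_smul]; abel
    rw [this, forceConst_add_right]
  -- off the ball: v q = 0
  have hout : ∀ q : ↑((SR.subtype (· ∈ Sites₀ t A) : Set (Sites₀ t A)))ᶜ,
      (if s ≠ ((q : Sites₀ t A) : EuclideanSpace ℝ (Fin 3)) then
        𝕂[s - ((q : Sites₀ t A) : EuclideanSpace ℝ (Fin 3))] (v s - v (q : Sites₀ t A)) else 0) =
      (if s ≠ ((q : Sites₀ t A) : EuclideanSpace ℝ (Fin 3)) then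
        𝕂[s - ((q : Sites₀ t A) : EuclideanSpace ℝ (Fin 3))] ((π s - s) - g s) else 0) := by
    intro q
    have hq : ((q : Sites₀ t A) : EuclideanSpace ℝ (Fin 3)) ∉ SR := by
      intro hmemq
      have : (q : Sites₀ t A) ∈ (SR.subtype (· ∈ Sites₀ t A) : Set (Sites₀ t A)) := by
        rw [Finset.mem_coe, Finset.mem_subtype]; exact hmemq
      exact q.2 this
    have hvq : v (q : Sites₀ t A) = 0 := by
      simp only [hvdef, hχ0 _ (q : Sites₀ t A).2 hq, zero_smul]
    rw [hvq, sub_zero, hvs]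
  rw [hfin, herase, Finset.sum_congr rfl hball, Finset.sum_add_distrib, tsum_congr hout]
  -- (3) combine with the force balance: `Ks = −E − Rs − Fs`
  have hK := eq_sub_of_add_eq' (eq_sub_of_add_eq hbal)
  rw [hK]
  simp only [hw]
  abel

end

end Summit.AtomisticToContinuum.Crystallization.Theorems.ExcessDecayLiouville

end
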